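import Literature.Analysis.FluidPDE.OnsagerBDSVPerturbationFlowBounds
import Literature.Analysis.FluidPDE.OnsagerBDSVPerturbationTildeR
import Literature.Analysis.FluidPDE.OnsagerBDSVFlowJacobian
import Literature.Analysis.FluidPDE.OnsagerBDSVDeformationBounds
import Literature.Analysis.FluidPDE.OnsagerBDSVDeformationBoundsProofs
import Literature.Analysis.FluidPDE.OnsagerBDSVDeformationBoundsTildeR
import Literature.Analysis.FluidPDE.DeRosaPerturbation
import HarnessLib

/-!
# De Rosa's perturbation stage: Lemma 5.9 and Prop. 5.11 (deformation matrix and conjugated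
# stress) under the core hypotheses — port of the BDSV deformation bounds

L. De Rosa, *Infinitely many Leray–Hopf solutions for the fractional Navier–Stokes equations*,
Comm. PDE 44 (2019) 335–365 = arXiv:1801.10235, §5.3 Lemma 5.9 ("`‖∇Φᵢ - Id‖₀ ≤ 1/2` for
`t ∈ supp ηᵢ`", "`R̃_{q,i}(x,t) ∈ B_{1/2}(Id)`", the bounds on `ρ_q`, `ρ_{q,i}`) and §5.5 Prop. 5.11,
first two displays ("`‖(∇Φᵢ)⁻¹‖_N + ‖∇Φᵢ‖_N ≲ ℓ^{-N}`, `‖R̃_{q,i}‖_N ≲ ℓ^{-N}`" — "a proposition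
taken from [BDLSV2017]" = Buckmaster–De Lellis–Székelyhidi–Vicol, CPAM 72 (2019), Lemma 5.4 and
Prop. 5.7 (5.23)–(5.24)). As the source says, these are the BDSV statements verbatim; their proofs
use of the input triple only its smoothness and the bounds (5.15)–(5.16) (BDSV (2.19)–(2.20)) —
no equation. This file is the tree's record of that remark: it re-runs the tree's BDSV proofs
(`OnsagerBDSVPerturbationFlowBounds`, `OnsagerBDSVPerturbationTildeR`, `OnsagerBDSVFlowJacobian`,
`OnsagerBDSVDeformationBounds`, `OnsagerBDSVDeformationBoundsProofs`,
`OnsagerBDSVDeformationBoundsTildeR`) VERBATIM under the weaker standing hypotheses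
`DeRosa.CoreHypotheses` of `DeRosaPerturbation.lean` (BDSV's `PerturbationHypotheses` with the
Euler–Reynolds system replaced by the regularity package + energy-rate bound), in the namespace
`DeRosa` (same names as their BDSV twins; `DeRosa.PerturbationData` abbreviates
`BDSV.PerturbationData` for dot-notation). Only the declarations whose proofs depend on the
standing hypotheses are re-run; everything else is used from the BDSV files.

* flow bounds: `CoreHypotheses.abs_partialDeriv_vbar_le`, `PerturbationData.abs_partialDeriv_D_le`
  (Lemma 5.4 (5.14): `|∂ⱼDᵢ| ≤ exp(t C_in δ_q^{1/2}λ_q) - 1` on the window of `ηᵢ`),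
  `CoreHypotheses.rhoQ_le/le_rhoQ`, `PerturbationData.rhoI_le` (the bounds on `ρ_q`, `ρ_{q,i}` of
  De Rosa Lemma 5.9 = BDSV (5.15)–(5.16));
* `PerturbationData.det_gradPhi_eq_one` (incompressibility: `det ∇Φᵢ = 1`);
* `CoreHypotheses.abs_Rbar_le`, `PerturbationData.tildeR_mem_closedBall` (Lemma 5.9:
  `R̃_{q,i} ∈ B̄_{1/10}(Id)` for `a` large);
* the two bounds of Prop. 5.11 as stage statements `DeRosa.gradPhiBound`, `DeRosa.tildeRBound`
  (the BDSV facts `BDSV.gradPhiBound`, `BDSV.tildeRBound` with `CoreHypotheses`), PROVED: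
  `DeRosa.gradPhiBound_holds`, `DeRosa.tildeRBound_holds` (ports of the BDSV discharges).

## References

* L. De Rosa, Comm. PDE 44 (2019) 335–365 = arXiv:1801.10235, §5.3 Lemma 5.9, §5.5 Prop. 5.11.
  [`Derosa2018`]
* T. Buckmaster, C. De Lellis, L. Székelyhidi Jr., V. Vicol, CPAM 72 (2019) 229–274 =
  arXiv:1701.08678, Lemma 5.4 (5.14)–(5.16), Prop. 5.7 (5.23)–(5.24). [`BuckmasterEtAl2018`]
-/

open MeasureTheory Set
open scoped NNReal ENNReal ContDiff Matrix Matrix.Norms.Elementwise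
open Set
open scoped ContDiff Matrix

noncomputable section

namespace Literature.Analysis.FluidPDE

namespace DeRosa

/-- The construction data of BDSV §5 (cut-offs and backward flows), `BDSV.PerturbationData`, abbreviated in this
namespace so that dot-notation finds the ported lemmas first. [folklore] -/
abbrev PerturbationData := @BDSV.PerturbationData

end DeRosa

/-! ## Port of `OnsagerBDSVDeformationBounds` -/

namespace DeRosa

open BDSV

open FunctionSpaces FunctionSpaces.Torus

/-- The flat three-torus `T³ = (ℝ/ℤ)³`, local notation. -/
local notation "𝕋³" => UnitAddTorus (Fin 3)

/-- Euclidean `ℝ³`, local notation. -/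
local notation "ℝ³" => EuclideanSpace ℝ (Fin 3)

/-- Real `3 × 3` matrices, local notation. -/
local notation "𝕄" => Matrix (Fin 3) (Fin 3) ℝ

section Intervals

end Intervals

section Facts

/-- **The deformation bound** (BDSV Prop. 5.7, first item, arXiv (5.23): "For `t ∈ Ĩ_i` and any
`N ≥ 0`, `‖(∇Φ_i)⁻¹‖_N + ‖∇Φ_i‖_N ≲ ℓ^{-N}`", constants depending on `N, α, β, M` but not on `a`;
proof from (2.19), (B.5)–(B.6) and `‖∇Φ_i - Id‖₀ ≤ 1/2` (Lemma 5.4), for `a` large). Transcription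
(module docstring): for the deformation `∇Φ_i = BDSV.gradPhi 𝒟.D i` of the backward flows of any
construction data and its matrix inverse, both `C^N` norms on `Ĩ_i` are at most `C ℓ^{-N}`.
[cite: BuckmasterEtAl2018, Prop. 5.7 (arXiv (5.23))] -/
def gradPhiBound : Prop :=
  ∀ (c₀ : ℝ), 0 < c₀ → ∀ Cη : ℕ → ℕ → ℝ,
    ∀ β : ℝ, 0 < β → β < 1 / 3 → ∀ b : ℝ, 1 < b → b < (1 - β) / (2 * β) →
      ∃ α₀ : ℝ, 0 < α₀ ∧ ∀ α : ℝ, 0 < α → α < α₀ → ∀ N : ℕ, ∃ Nbar : ℕ, ∀ Cin C₀ : ℝ,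
        ∃ C a₀ : ℝ, 1 < a₀ ∧ ∀ a : ℝ, a₀ ≤ a → ∀ S : Setting,
          CoreHypotheses ⟨β, α, a, b⟩ S Nbar Cin C₀ →
            ∀ (𝒟 : PerturbationData ⟨β, α, a, b⟩ S c₀ Cη) (i : ℕ),
              HolderSupOnLE (tildeInterval S.T (Params.τ ⟨β, α, a, b⟩ S.q) i)
                  (fun t x => gradPhi 𝒟.D i t x) N 0
                  (C * mollScale β α a b S.q ^ (-(N : ℝ))) ∧
                HolderSupOnLE (tildeInterval S.T (Params.τ ⟨β, α, a, b⟩ S.q) i)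
                  (fun t x => (gradPhi 𝒟.D i t x)⁻¹) N 0
                  (C * mollScale β α a b S.q ^ (-(N : ℝ)))

/-- **The conjugated-stress bound** (BDSV Prop. 5.7, second item, arXiv (5.24): "For `t ∈ Ĩ_i` and
any `N ≥ 0`, `‖R̃_{q,i}‖_N ≲ ℓ^{-N}`"; proof: the form arXiv (5.27)
`R_{q,i}/ρ_{q,i} = Id - (Σ_j∫η_j²/ρ_q) R̊̄_q` valid on `supp R̊̄_q`, (5.28), Lemma 5.4 and (5.23)).
Transcription (module docstring): for `R̃_{q,i} = BDSV.tildeR` (which is the (5.27) form globally),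
`‖R̃_{q,i}(t)‖_{C^N} ≤ C ℓ^{-N}` for `t ∈ Ĩ_i`. [cite: BuckmasterEtAl2018, Prop. 5.7 (arXiv (5.24))] -/
def tildeRBound : Prop :=
  ∀ (c₀ : ℝ), 0 < c₀ → ∀ Cη : ℕ → ℕ → ℝ,
    ∀ β : ℝ, 0 < β → β < 1 / 3 → ∀ b : ℝ, 1 < b → b < (1 - β) / (2 * β) →
      ∃ α₀ : ℝ, 0 < α₀ ∧ ∀ α : ℝ, 0 < α → α < α₀ → ∀ N : ℕ, ∃ Nbar : ℕ, ∀ Cin C₀ : ℝ,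
        ∃ C a₀ : ℝ, 1 < a₀ ∧ ∀ a : ℝ, a₀ ≤ a → ∀ S : Setting,
          CoreHypotheses ⟨β, α, a, b⟩ S Nbar Cin C₀ →
            ∀ (𝒟 : PerturbationData ⟨β, α, a, b⟩ S c₀ Cη) (i : ℕ),
              HolderSupOnLE (tildeInterval S.T (Params.τ ⟨β, α, a, b⟩ S.q) i)
                (fun t x => tildeR ⟨β, α, a, b⟩ S 𝒟.cut.η 𝒟.D i t x) N 0
                (C * mollScale β α a b S.q ^ (-(N : ℝ)))

end Facts

end DeRosa

/-! ## Port of `OnsagerBDSVPerturbationFlowBounds` -/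

namespace DeRosa

open BDSV

open FunctionSpaces FunctionSpaces.Torus

/-- The flat three-torus `T³ = (ℝ/ℤ)³`, local notation. -/
local notation "𝕋³" => UnitAddTorus (Fin 3)

/-- Euclidean `ℝ³`, local notation. -/
local notation "ℝ³" => EuclideanSpace ℝ (Fin 3)

section Bridge

variable {F : Type*} [NormedAddCommGroup F] [NormedSpace ℝ F]

end Bridge

section FlowBounds

variable {P : Params} {S : Setting} {Nbar : ℕ} {Cin C₀ c₀ : ℝ} {Cη : ℕ → ℕ → ℝ}

/-- The pointwise velocity-gradient bound extracted from (2.19)|_{N=0}: `|∂ⱼ v̄_k| ≤ C_in δ_q^{1/2} λ_q`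
on `[0,T] × T³` (for `C_in ≥ 0`, `a ≥ 1`). [cite: BuckmasterEtAl2018, §2.5 (2.19)] -/
theorem CoreHypotheses.abs_partialDeriv_vbar_le (H : CoreHypotheses P S Nbar Cin C₀)
    (hCin : 0 ≤ Cin) (ha : 1 ≤ P.a) {s : ℝ} (hs : s ∈ Icc 0 S.T) (x : 𝕋³) (j k : Fin 3) :
    |Torus.partialDeriv j (S.vbar s) x k| ≤ Cin * (Real.sqrt (amp P.β P.a P.b S.q) * freq P.a P.b S.q) := by
  have hv := H.velocity 0 (Nat.zero_le _) s hs
  simp only [Nat.cast_zero, neg_zero, Real.rpow_zero, mul_one] at hv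
  have hB : 0 ≤ Cin * (Real.sqrt (amp P.β P.a P.b S.q) * freq P.a P.b S.q) :=
    mul_nonneg hCin (mul_nonneg (Real.sqrt_nonneg _) (freq_pos ha _).le)
  have h1 := norm_partialDeriv_le_of_eContDiffHolderNorm_le
    ((H.eulerReynolds.smooth_velocity.isSmooth_slice hs).isContDiff (by simp)) hB hv j x
  have h2 : |Torus.partialDeriv j (S.vbar s) x k| ≤ ‖Torus.partialDeriv j (S.vbar s) x‖ := by
    rw [← Real.norm_eq_abs]
    exact PiLp.norm_apply_le _ k
  exact h2.trans h1

/-- **Deformation of the backward flows along `[0,T]`** (BDSV Lemma 5.4, first display, via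
App. B (B.4)): `|∂ⱼ(Φᵢ - id)_a(t, x)| ≤ exp(3 K |t - tᵢ*|) - 1` with `K = C_in δ_q^{1/2} λ_q` the
bound of (2.19)|₀ and `tᵢ* = min(tᵢ, T)` the anchor of `Φᵢ`. [cite: BuckmasterEtAl2018, Lemma 5.4 (5.14)] -/
theorem PerturbationData.abs_partialDeriv_D_le (H : CoreHypotheses P S Nbar Cin C₀)
    (𝒟 : PerturbationData P S c₀ Cη) (hCin : 0 ≤ Cin) (ha : 1 ≤ P.a) (i : ℕ) {t : ℝ} (ht : t ∈ Icc 0 S.T)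
    (x : 𝕋³) (a j : Fin 3) :
    |Torus.partialDeriv j (𝒟.D i t) x a| ≤
      Real.exp (3 * (Cin * (Real.sqrt (amp P.β P.a P.b S.q) * freq P.a P.b S.q)) *
        |t - min ((i : ℝ) * P.τ S.q) S.T|) - 1 := by
  have hτ : 0 < P.τ S.q := glueScale_pos ha S.q
  have hanchor : min ((i : ℝ) * P.τ S.q) S.T ∈ Icc 0 S.T :=
    ⟨le_min (mul_nonneg i.cast_nonneg hτ.le) H.pos_T.le, min_le_right _ _⟩
  have h := Literature.Analysis.ODE.abs_partialDeriv_le_of_transport_id H.pos_T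
    H.eulerReynolds.smooth_velocity (𝒟.flow i).smooth hanchor (𝒟.flow i).anchor (𝒟.flow i).transport
    (mul_nonneg hCin (mul_nonneg (Real.sqrt_nonneg _) (freq_pos ha _).le))
    (fun s hs y j' k => H.abs_partialDeriv_vbar_le hCin ha hs y j' k) ht x a j
  rw [Fintype.card_fin] at h
  norm_num at h
  exact h

/-- **Deformation on the support of the cut-offs**: if `ηᵢ(t, ·) ≠ 0` somewhere then
`|∂ⱼ(Φᵢ - id)_a(t, x)| ≤ exp(4 C_in ℓ^{2α}) - 1` for every `x` (BDSV Lemma 5.4: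
`‖∇Φᵢ - Id‖₀ ≲ τ_q δ_q^{1/2} λ_q = ℓ^{2α}` for `t ∈ supp ηᵢ`). [cite: BuckmasterEtAl2018, Lemma 5.4 (5.14)] -/
theorem PerturbationData.abs_partialDeriv_D_le_of_eta_ne_zero (H : CoreHypotheses P S Nbar Cin C₀)
    (𝒟 : PerturbationData P S c₀ Cη) (hCin : 0 ≤ Cin) (ha : 1 ≤ P.a) {i : ℕ} {t : ℝ} (ht : t ∈ Icc 0 S.T)
    {x' : 𝕋³} (hη : 𝒟.cut.η i t x' ≠ 0) (x : 𝕋³) (a j : Fin 3) :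
    |Torus.partialDeriv j (𝒟.D i t) x a| ≤ Real.exp (4 * (Cin * mollScale P.β P.α P.a P.b S.q ^ (2 * P.α))) - 1 := by
  have hτ : 0 < P.τ S.q := glueScale_pos ha S.q
  have hK : 0 ≤ Cin * (Real.sqrt (amp P.β P.a P.b S.q) * freq P.a P.b S.q) :=
    mul_nonneg hCin (mul_nonneg (Real.sqrt_nonneg _) (freq_pos ha _).le)
  have h1 := 𝒟.abs_partialDeriv_D_le H hCin ha i ht x a j
  have h2 := CutoffFamily.abs_sub_anchor_le hτ 𝒟.cut ht hη
  refine h1.trans (sub_le_sub_right (Real.exp_le_exp.2 ?_) _)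
  calc 3 * (Cin * (Real.sqrt (amp P.β P.a P.b S.q) * freq P.a P.b S.q)) * |t - min ((i : ℝ) * P.τ S.q) S.T|
      ≤ 3 * (Cin * (Real.sqrt (amp P.β P.a P.b S.q) * freq P.a P.b S.q)) * (4 * P.τ S.q / 3) :=
        mul_le_mul_of_nonneg_left h2 (by positivity)
    _ = 4 * (Cin * (Real.sqrt (amp P.β P.a P.b S.q) * freq P.a P.b S.q) * P.τ S.q) := by ring
    _ = 4 * (Cin * mollScale P.β P.α P.a P.b S.q ^ (2 * P.α)) := by rw [velocityBound_mul_tau ha]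

end FlowBounds

section Rho

variable {P : Params} {S : Setting} {Nbar : ℕ} {Cin C₀ c₀ : ℝ} {Cη : ℕ → ℕ → ℝ}

/-- **(5.15), upper half**: `ρ_q(t) ≤ δ_{q+1}` on `[0,T]` (from (5.2) and `δ_{q+2} ≥ 0`). [cite: BuckmasterEtAl2018, Lemma 5.4 (5.15)] -/
theorem CoreHypotheses.rhoQ_le (H : CoreHypotheses P S Nbar Cin C₀) (ha : 1 ≤ P.a)
    {t : ℝ} (ht : t ∈ Icc 0 S.T) : rhoQ P S t ≤ amp P.β P.a P.b (S.q + 1) := by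
  have h1 := (H.energy_gap t ht).2
  have h2 : 0 ≤ amp P.β P.a P.b (S.q + 2) := (amp_pos ha _).le
  have h3 : 0 ≤ amp P.β P.a P.b (S.q + 1) := (amp_pos ha _).le
  unfold rhoQ
  linarith

/-- **(5.15), lower half**: `δ_{q+1} λ_q^{-α} / 8 ≤ ρ_q(t)` on `[0,T]`, given (5.2) and
`4δ_{q+2} ≤ δ_{q+1}λ_q^{-α}` (true for `a` large, `BDSV.exists_threshold_four_amp`). [cite: BuckmasterEtAl2018, Lemma 5.4 (5.15)] -/
theorem CoreHypotheses.le_rhoQ (H : CoreHypotheses P S Nbar Cin C₀)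
    (h4 : 4 * amp P.β P.a P.b (S.q + 2) ≤ amp P.β P.a P.b (S.q + 1) * freq P.a P.b S.q ^ (-P.α))
    {t : ℝ} (ht : t ∈ Icc 0 S.T) :
    amp P.β P.a P.b (S.q + 1) * freq P.a P.b S.q ^ (-P.α) / 8 ≤ rhoQ P S t := by
  have h1 := (H.energy_gap t ht).1
  unfold rhoQ
  linarith

/-- **(5.16)**: `0 ≤ ρ_{q,i} ≤ δ_{q+1}/c₀` on `[0,T]` (given `0 ≤ ρ_q ≤ δ_{q+1}`, `c₀ ≤ ∑∫η² `, `c₀ > 0`).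
[cite: BuckmasterEtAl2018, Lemma 5.4 (5.16)] -/
theorem PerturbationData.rhoI_le (H : CoreHypotheses P S Nbar Cin C₀) (𝒟 : PerturbationData P S c₀ Cη)
    (hc₀ : 0 < c₀) (ha : 1 ≤ P.a) (hρ : ∀ t ∈ Icc 0 S.T, 0 ≤ rhoQ P S t) {t : ℝ} (ht : t ∈ Icc 0 S.T)
    (i : ℕ) (x : 𝕋³) :
    0 ≤ rhoI P S 𝒟.cut.η i t x ∧ rhoI P S 𝒟.cut.η i t x ≤ amp P.β P.a P.b (S.q + 1) / c₀ := by
  have hm : c₀ ≤ etaMass P S 𝒟.cut.η t := 𝒟.le_etaMass ht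
  have hm0 : 0 < etaMass P S 𝒟.cut.η t := hc₀.trans_le hm
  have hη2 : 𝒟.cut.η i t x ^ 2 ≤ 1 := by
    have h1 := 𝒟.cut.nonneg i t x; have h2 := 𝒟.cut.le_one i t x; nlinarith
  have hq : 0 ≤ rhoQ P S t / etaMass P S 𝒟.cut.η t := div_nonneg (hρ t ht) hm0.le
  unfold rhoI
  refine ⟨mul_nonneg (sq_nonneg _) hq, ?_⟩
  calc 𝒟.cut.η i t x ^ 2 * (rhoQ P S t / etaMass P S 𝒟.cut.η t)
      ≤ 1 * (rhoQ P S t / etaMass P S 𝒟.cut.η t) := mul_le_mul_of_nonneg_right hη2 hq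
    _ ≤ amp P.β P.a P.b (S.q + 1) / c₀ := by
        rw [one_mul]
        exact div_le_div₀ (amp_pos ha _).le (H.rhoQ_le ha ht) hc₀ hm

end Rho

end DeRosa

/-! ## Port of `OnsagerBDSVFlowJacobian` -/

namespace DeRosa

open BDSV

open FunctionSpaces FunctionSpaces.Torus

section Jacobi

end Jacobi

section Chain

variable {E E' : Type*} [NormedAddCommGroup E] [NormedSpace ℝ E] [NormedAddCommGroup E']
  [NormedSpace ℝ E'] {T : ℝ} {v : ℝ → UnitAddTorus (Fin 3) → EuclideanSpace ℝ (Fin 3)}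

end Chain

section Liouville

variable {T : ℝ} {v D : ℝ → UnitAddTorus (Fin 3) → EuclideanSpace ℝ (Fin 3)}

/-- **The backward flows are volume preserving**: for a jointly smooth divergence-free velocity
field `v` on `[0,T] × T³` (`T > 0`) and a backward flow `Φ = id + D` anchored at `t₀ ∈ [0,T]`
(`BDSV.FlowDisplacement T v t₀`), `det ∇Φ(t, x) = det(Id + ∇D(t,x)) = 1` on `[0,T] × T³`.
[cite: BuckmasterEtAl2018, §5.3 (cof ∇Φᵀ = ∇Φ⁻¹, before (5.28))] -/
theorem FlowDisplacement.det_gradPhi_eq_one (hT : 0 < T) (hv : Torus.IsSmoothSpaceTimeOn (Icc 0 T) v)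
    (hdiv : ∀ s ∈ Icc 0 T, IsDivFree (v s)) {t₀ : ℝ} (ht₀ : t₀ ∈ Icc 0 T)
    (Φ : FlowDisplacement T v t₀) {t : ℝ} (ht : t ∈ Icc 0 T) (x : UnitAddTorus (Fin 3)) :
    ((1 : Matrix (Fin 3) (Fin 3) ℝ) + Matrix.of fun a b => Torus.partialDeriv b (Φ.D t) x a).det = 1 := by
  have h := det_one_add_jacobian_eq_one hT hv Φ.smooth (fun s hs y => Φ.advectiveDeriv_eq hs y)
    hdiv ht₀ Φ.anchor ht x
  have hc : IsContDiff 1 (Φ.D t) := (Φ.smooth.isSmooth_slice ht).isContDiff (by simp)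
  have hm : (Matrix.of fun a b => Torus.partialDeriv b (Φ.D t) x a) =
      Matrix.of fun a b : Fin 3 => (gradField Φ.D t x (EuclideanSpace.single b 1)) a := by
    ext a b
    simp only [Matrix.of_apply, gradField_apply, partialDeriv_eq_fderiv_apply hc]
  rw [hm]
  exact h

/-- **`det ∇Φ_i = 1` for the construction data of the perturbation step**: under the standing
hypotheses (`v̄_q` divergence free, `T > 0`) and for `a ≥ 1` (so that the anchors
`min(t_i, T)`, `t_i = iτ_q ≥ 0`, lie in `[0,T]`), the deformation matrices `BDSV.gradPhi` of the
backward flows of any `BDSV.PerturbationData` have unit determinant on `[0,T] × T³`.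
[cite: BuckmasterEtAl2018, §5.3 (cof ∇Φᵀ = ∇Φ⁻¹, before (5.28))] -/
theorem PerturbationData.det_gradPhi_eq_one {P : Params} {S : Setting} {Nbar : ℕ}
    {Cin C₀ c₀ : ℝ} {Cη : ℕ → ℕ → ℝ} (H : CoreHypotheses P S Nbar Cin C₀)
    (𝒟 : PerturbationData P S c₀ Cη) (ha : 1 ≤ P.a) (i : ℕ) {t : ℝ} (ht : t ∈ Icc 0 S.T)
    (x : UnitAddTorus (Fin 3)) : (gradPhi 𝒟.D i t x).det = 1 := by
  have hτ : 0 < P.τ S.q := glueScale_pos ha S.q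
  have hanchor : min ((i : ℝ) * P.τ S.q) S.T ∈ Icc 0 S.T :=
    ⟨le_min (mul_nonneg i.cast_nonneg hτ.le) H.pos_T.le, min_le_right _ _⟩
  exact (𝒟.flow i).det_gradPhi_eq_one H.pos_T H.eulerReynolds.smooth_velocity
    H.eulerReynolds.divFree hanchor ht x

end Liouville

end DeRosa

/-! ## Port of `OnsagerBDSVDeformationBoundsProofs` -/

namespace DeRosa

open BDSV

open FunctionSpaces FunctionSpaces.Torus

section Generic

variable {d : Type} [Fintype d] {Y : Type} [NormedAddCommGroup Y] [NormedSpace ℝ Y]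

end Generic

section Displacement

variable {d : Type} [Fintype d] [DecidableEq d]

end Displacement

section MatrixFields

variable {d : Type} [Fintype d]

variable [DecidableEq d]

end MatrixFields

section Assembly

/-- **The deformation bound holds** (BDSV Prop. 5.7, first item, arXiv (5.23): for `t ∈ Ĩ_i`,
`‖(∇Φ_i)⁻¹‖_N + ‖∇Φ_i‖_N ≲ ℓ^{-N}`). Proof as printed: the all-orders transport bound (B.6) for
the displacement `Φ_i - id` on the interval `Ĩ_i` (length `≤ 5τ_q/3` around the anchor), fed with
(2.19) and the smallness `τ_q δ_q^{1/2} λ_q = ℓ^{2α} → 0` (`a` large), gives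
`‖∇Φ_i - Id‖_{N} ≤ ℓ^{-N}`; the inverse is the adjugate (`det ∇Φ_i = 1`), quadratic in the
entries, and is estimated by the Leibniz rule. The constant is `C = 72 (N+1) 3ᴺ`, with `α₀ = 1`,
`N̄ = N`. [cite: BuckmasterEtAl2018, Prop. 5.7 (arXiv (5.23))] -/
theorem gradPhiBound_holds : gradPhiBound := by
  intro c₀ _hc₀ Cη β hβ _hβ3 b hb1 _hb2
  refine ⟨1, one_pos, ?_⟩
  intro α hα _hα1 N
  obtain ⟨K, hK2, hK⟩ := displacement_allOrders (d := Fin 3) N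
  refine ⟨N, ?_⟩
  intro Cin C₀
  obtain ⟨a₀, ha₀1, ha₀⟩ :=
    exists_threshold_mollScale_rpow_le hβ.le hb1.le hα (5 / 3 * K * |Cin|) one_pos
  refine ⟨72 * ((N : ℝ) + 1) * 3 ^ N, a₀, ha₀1, ?_⟩
  intro a ha S H 𝒟 i
  -- parameters
  have ha1 : 1 ≤ a := ha₀1.le.trans ha
  have hK0 : 0 ≤ K := zero_le_two.trans hK2
  have hℓ : 0 < mollScale β α a b S.q := mollScale_pos ha1 _
  have hℓ1 : mollScale β α a b S.q ≤ 1 := mollScale_le_one_of_params ha1 hb1.le hβ.le hα.le S.q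
  have hτ : 0 < Params.τ ⟨β, α, a, b⟩ S.q := glueScale_pos ha1 _
  have hT : 0 < S.T := H.pos_T
  set ℓ := mollScale β α a b S.q with hℓdef
  set τ := Params.τ ⟨β, α, a, b⟩ S.q with hτdef
  set M := ℓ⁻¹ with hMdef
  have hM1 : 1 ≤ M := (one_le_inv₀ hℓ).2 hℓ1
  have hM0 : 0 ≤ M := zero_le_one.trans hM1
  have hMpow : ∀ n : ℕ, ℓ ^ (-(n : ℝ)) = M ^ n := fun n => by
    rw [Real.rpow_neg hℓ.le, Real.rpow_natCast, hMdef, inv_pow]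
  have hMk : ∀ k : ℕ, 1 ≤ M ^ k := fun k => one_le_pow₀ hM1
  set Λ := |Cin| * (Real.sqrt (amp β a b S.q) * freq a b S.q) with hΛdef
  have hX0 : 0 ≤ Real.sqrt (amp β a b S.q) * freq a b S.q :=
    mul_nonneg (Real.sqrt_nonneg _) (freq_pos ha1 _).le
  have hΛ0 : 0 ≤ Λ := mul_nonneg (abs_nonneg _) hX0
  -- `Λ τ_q = |C_in| ℓ^{2α}` and the smallness for `a ≥ a₀`
  have hΛτ : Λ * τ = |Cin| * ℓ ^ (2 * α) :=
    velocityBound_mul_tau (P := ⟨β, α, a, b⟩) (Cin := |Cin|) ha1 S.q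
  have hsmall0 : 5 / 3 * K * |Cin| * ℓ ^ (2 * α) ≤ 1 := ha₀ a ha S.q
  -- (2.19) in the form `‖v̄_q(s)‖_{j+1} ≤ Λ M^j`
  have hvb : ∀ s ∈ Icc 0 S.T, ∀ j ≤ N,
      Torus.eContDiffHolderNorm (j + 1) 0 (S.vbar s) ≤ ENNReal.ofReal (Λ * M ^ j) := by
    intro s hs j hj
    refine (H.velocity j hj s hs).trans (ENNReal.ofReal_le_ofReal ?_)
    change Cin * (Real.sqrt (amp β a b S.q) * freq a b S.q * ℓ ^ (-(j : ℝ))) ≤ Λ * M ^ j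
    rw [hMpow j, hΛdef]
    calc Cin * (Real.sqrt (amp β a b S.q) * freq a b S.q * M ^ j)
        ≤ |Cin| * (Real.sqrt (amp β a b S.q) * freq a b S.q * M ^ j) :=
          mul_le_mul_of_nonneg_right (le_abs_self Cin) (mul_nonneg hX0 (zero_le_one.trans (hMk j)))
      _ = _ := by ring
  -- the transport equation of `D_i` on `[0,T]`
  have heq0 : ∀ s ∈ Icc 0 S.T, ∀ x, Torus.timeDerivWithin (Icc 0 S.T) (𝒟.D i) s x +
      Torus.convect (S.vbar s) (𝒟.D i s) x = -S.vbar s x :=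
    fun s hs x => eq_neg_of_add_eq_zero_left ((𝒟.flow i).transport s hs x)
  have hDsm : Torus.IsSmoothSpaceTimeOn (Icc 0 S.T) (𝒟.D i) := (𝒟.flow i).smooth
  have hvsm : Torus.IsSmoothSpaceTimeOn (Icc 0 S.T) S.vbar := H.eulerReynolds.smooth_velocity
  -- the final constant dominates the two intermediate ones
  have hC1 : (1 : ℝ) ≤ ((N : ℝ) + 1) * 3 ^ N := by
    have h3 : (1 : ℝ) ≤ 3 ^ N := one_le_pow₀ (by norm_num)
    have hN : (0 : ℝ) ≤ N := Nat.cast_nonneg N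
    nlinarith
  -- the bounds for `t ∈ Ĩ_i`
  have key : ∀ t ∈ tildeInterval S.T τ i,
      Torus.eContDiffHolderNorm N 0 (fun x => gradPhi 𝒟.D i t x) ≤
          ENNReal.ofReal (72 * ((N : ℝ) + 1) * 3 ^ N * ℓ ^ (-(N : ℝ))) ∧
        Torus.eContDiffHolderNorm N 0 (fun x => (gradPhi 𝒟.D i t x)⁻¹) ≤
          ENNReal.ofReal (72 * ((N : ℝ) + 1) * 3 ^ N * ℓ ^ (-(N : ℝ))) := by
    intro t ht
    obtain ⟨ht0, ht1⟩ := ht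
    -- the interval `[a', b'] ⊇ Ĩ_i`
    set a' := max 0 ((i : ℝ) * τ - τ / 3) with ha'def
    set b' := min S.T (((i : ℝ) + 1) * τ + τ / 3) with hb'def
    have hi0 : 0 ≤ (i : ℝ) * τ := mul_nonneg i.cast_nonneg hτ.le
    have hab' : a' < b' := by
      refine max_lt (lt_min hT (by linarith [ht1.2, ht0.1])) (lt_min (by linarith [ht1.1, ht0.2]) ?_)
      nlinarith
    have hsub : Icc a' b' ⊆ Icc 0 S.T := fun s hs =>
      ⟨(le_max_left _ _).trans hs.1, hs.2.trans (min_le_left _ _)⟩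
    have ht' : t ∈ Icc a' b' := ⟨max_le ht0.1 ht1.1.le, le_min ht0.2 ht1.2.le⟩
    have ht₀ : min ((i : ℝ) * τ) S.T ∈ Icc a' b' := by
      refine ⟨max_le (le_min hi0 hT.le) (le_min (by linarith) (by linarith [ht1.1, ht0.2])),
        le_min (min_le_right _ _) ((min_le_left _ _).trans (by nlinarith))⟩
    have hlen : b' - a' ≤ 5 / 3 * τ := by
      have h1 : b' ≤ ((i : ℝ) + 1) * τ + τ / 3 := min_le_right _ _
      have h2 : (i : ℝ) * τ - τ / 3 ≤ a' := le_max_right _ _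
      nlinarith
    have hL0 : 0 ≤ b' - a' := (sub_pos.2 hab').le
    -- smallness on `[a', b']`
    have hsmall : (b' - a') * Λ * K ≤ 1 := by
      calc (b' - a') * Λ * K ≤ (5 / 3 * τ) * Λ * K :=
            mul_le_mul_of_nonneg_right (mul_le_mul_of_nonneg_right hlen hΛ0) hK0
        _ = 5 / 3 * K * (Λ * τ) := by ring
        _ = 5 / 3 * K * |Cin| * ℓ ^ (2 * α) := by rw [hΛτ]; ring
        _ ≤ 1 := hsmall0
    have hKLΛ : K * ((b' - a') * Λ) ≤ 1 := by
      calc K * ((b' - a') * Λ) = (b' - a') * Λ * K := by ring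
        _ ≤ 1 := hsmall
    -- the all-orders bound for `D_i` on `[a', b']`
    have heq' := transport_restrict hab' hsub hDsm heq0
    have hDb : ∀ n ≤ N, Torus.eContDiffHolderNorm (n + 1) 0 (𝒟.D i t) ≤ ENNReal.ofReal (M ^ n) := by
      intro n hn
      have h := hK hab' (hvsm.mono hsub) (hDsm.mono hsub) heq' ht₀ (𝒟.flow i).anchor hΛ0 hM1
        (fun s hs j hj => hvb s (hsub hs) j hj) hsmall t ht' n hn
      refine h.trans (ENNReal.ofReal_le_ofReal ?_)
      calc K * ((b' - a') * Λ) * M ^ n ≤ 1 * M ^ n :=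
            mul_le_mul_of_nonneg_right hKLΛ (zero_le_one.trans (hMk n))
        _ = M ^ n := one_mul _
    have hDt : IsSmooth (𝒟.D i t) := hDsm.isSmooth_slice ht0
    have hfinal : 0 ≤ 72 * ((N : ℝ) + 1) * 3 ^ N * M ^ N := by positivity
    constructor
    · -- `‖∇Φ_i(t)‖_N ≤ 9 (1 + M^N) ≤ 72 (N+1) 3^N M^N`
      refine (eContDiffHolderNorm_gradPhi_le hDt N 0).trans ?_
      rw [hMpow N]
      calc (9 : ℝ≥0∞) * (1 + Torus.eContDiffHolderNorm (N + 1) 0 (𝒟.D i t))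
          ≤ 9 * (1 + ENNReal.ofReal (M ^ N)) := by gcongr; exact hDb N le_rfl
        _ = ENNReal.ofReal (9 * (1 + M ^ N)) := by
            rw [ENNReal.ofReal_mul (by norm_num), ENNReal.ofReal_ofNat,
              ENNReal.ofReal_add zero_le_one (zero_le_one.trans (hMk N)), ENNReal.ofReal_one]
        _ ≤ ENNReal.ofReal (72 * ((N : ℝ) + 1) * 3 ^ N * M ^ N) := by
            refine ENNReal.ofReal_le_ofReal ?_
            have h1 : 9 * (1 + M ^ N) ≤ 18 * M ^ N := by linarith [hMk N]
            have h2 : 18 * M ^ N ≤ 72 * (((N : ℝ) + 1) * 3 ^ N) * M ^ N := by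
              have := hMk N
              nlinarith
            linarith
    · -- `(∇Φ_i)⁻¹ = adj ∇Φ_i` since `det ∇Φ_i = 1`
      have hinv : (fun x => (gradPhi 𝒟.D i t x)⁻¹) = fun x => (gradPhi 𝒟.D i t x).adjugate := by
        funext x
        rw [Matrix.inv_def, 𝒟.det_gradPhi_eq_one H ha1 i ht0 x, Ring.inverse_one, one_smul]
      rw [hinv, hMpow N]
      refine (eContDiffHolderNorm_adjugate_gradPhi_le hDt N 0 (B := fun j => M ^ j)
        (fun j => zero_le_one.trans (hMk j)) hDb).trans (ENNReal.ofReal_le_ofReal ?_)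
      -- `18 · 3^N Σ_{j ≤ N} (1 + M^j)(1 + M^{N-j}) ≤ 72 (N+1) 3^N M^N`
      have hterm : ∀ j ∈ Finset.range (N + 1), (1 + M ^ j) * (1 + M ^ (N - j)) ≤ 4 * M ^ N := by
        intro j hj
        have hjN : j ≤ N := Nat.lt_succ_iff.1 (Finset.mem_range.1 hj)
        have hpow : M ^ j * M ^ (N - j) = M ^ N := by rw [← pow_add, Nat.add_sub_cancel' hjN]
        have h1 : 1 + M ^ j ≤ 2 * M ^ j := by linarith [hMk j]
        have h2 : 1 + M ^ (N - j) ≤ 2 * M ^ (N - j) := by linarith [hMk (N - j)]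
        calc (1 + M ^ j) * (1 + M ^ (N - j)) ≤ (2 * M ^ j) * (2 * M ^ (N - j)) :=
              mul_le_mul h1 h2 (by positivity) (by positivity)
          _ = 4 * M ^ N := by rw [← hpow]; ring
      have hsum : ∑ j ∈ Finset.range (N + 1), (1 + M ^ j) * (1 + M ^ (N - j)) ≤
          ((N : ℝ) + 1) * (4 * M ^ N) := by
        refine (Finset.sum_le_sum hterm).trans ?_
        rw [Finset.sum_const, Finset.card_range, nsmul_eq_mul]
        push_cast
        exact le_rfl
      calc 18 * (3 ^ N * ∑ j ∈ Finset.range (N + 1), (1 + M ^ j) * (1 + M ^ (N - j)))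
          ≤ 18 * (3 ^ N * (((N : ℝ) + 1) * (4 * M ^ N))) := by gcongr
        _ = 72 * ((N : ℝ) + 1) * 3 ^ N * M ^ N := by ring
  exact ⟨fun t ht => (key t ht).1, fun t ht => (key t ht).2⟩

end Assembly

end DeRosa

/-! ## Port of `OnsagerBDSVDeformationBoundsTildeR` -/

set_option maxSynthPendingDepth 3

namespace DeRosa

open BDSV

open FunctionSpaces FunctionSpaces.Torus

section HolderTools

variable {d : Type} [Fintype d] {Y Y₁ Y₂ Z : Type} [NormedAddCommGroup Y] [NormedSpace ℝ Y]
  [NormedAddCommGroup Y₁] [NormedSpace ℝ Y₁] [NormedAddCommGroup Y₂] [NormedSpace ℝ Y₂]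
  [NormedAddCommGroup Z] [NormedSpace ℝ Z]

end HolderTools

section MatrixTools

/-- `‖Id‖ ≤ 1` for the elementwise sup norm on `3 × 3` matrices (a private copy of the lemma
of `OnsagerBDSVEnergyCrossTerm.lean`, to keep the import graph of the deformation bounds
disjoint from the energy estimates). [folklore] -/
private theorem matrixNorm_one_le : ‖(1 : Matrix (Fin 3) (Fin 3) ℝ)‖ ≤ 1 := by
  refine (Matrix.norm_le_iff zero_le_one).2 fun i j => ?_
  rw [Matrix.one_apply]
  split_ifs <;> simp

/-- `‖A B‖ ≤ 3 ‖A‖ ‖B‖` for the elementwise sup norm on `3 × 3` matrices (three terms in each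
entry; a private copy of the lemma of `OnsagerBDSVEnergyTools.lean`, same reason). [folklore] -/
private theorem matrixNorm_mul_le (A B : Matrix (Fin 3) (Fin 3) ℝ) : ‖A * B‖ ≤ 3 * ‖A‖ * ‖B‖ := by
  refine (Matrix.norm_le_iff (by positivity)).2 fun i j => ?_
  rw [Matrix.mul_apply]
  calc ‖∑ k, A i k * B k j‖ ≤ ∑ k, ‖A i k * B k j‖ := norm_sum_le _ _
    _ ≤ ∑ _k : Fin 3, ‖A‖ * ‖B‖ := Finset.sum_le_sum fun k _ => by
        rw [norm_mul]
        exact mul_le_mul (Matrix.norm_entry_le_entrywise_sup_norm A)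
          (Matrix.norm_entry_le_entrywise_sup_norm B) (norm_nonneg _) (norm_nonneg _)
    _ = 3 * ‖A‖ * ‖B‖ := by
        rw [Finset.sum_const, Finset.card_univ, Fintype.card_fin, nsmul_eq_mul]
        push_cast
        ring

end MatrixTools

section Displacement

variable {P : Params} {S : Setting} {Nbar : ℕ} {Cin C₀ c₀ : ℝ} {Cη : ℕ → ℕ → ℝ}

/-- **The displacements on `Ĩ_i` at all orders** (the content of App. B (B.5)–(B.6) for the
backward flows of `v̄_q`, as used in the proof of Prop. 5.7: "`‖∇Φ_i‖_N ≲ 1 + τ_q‖Dv̄_q‖_N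
≲ 1 + τ_q δ_q^{1/2} λ_q ℓ^{-N}`", `τ_q δ_q^{1/2} λ_q = ℓ^{2α}`). For every `N` there is
`K = K(N) ≥ 2` such that, under the standing hypotheses with `N̄ ≥ N` and the CFL-type smallness
`3 K |C_in| ℓ^{2α} ≤ 1`, for all `i`, `t ∈ Ĩ_i` and `m ≤ N`:
`‖D_i(t)‖_{m+1,0} ≤ 3 K |C_in| ℓ^{2α} ℓ^{-m}` (`D_i = Φ_i - id`; the transport bound
`BDSV.displacement_allOrders` on `J_i = [max(0,tᵢ-τ_q), min(T,tᵢ+2τ_q)] ⊇ Ĩ_i`, `|J_i| ≤ 3τ_q`).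
[cite: BuckmasterEtAl2018, Prop. 5.7 (proof of (5.23)); App. B (B.5)–(B.6)] -/
theorem holder_displacement_tildeInterval (N : ℕ) : ∃ K : ℝ, 2 ≤ K ∧
    ∀ {P : Params} {S : Setting} {Nbar : ℕ} {Cin C₀ c₀ : ℝ} {Cη : ℕ → ℕ → ℝ}
      (_ : CoreHypotheses P S Nbar Cin C₀) (𝒟 : PerturbationData P S c₀ Cη),
      1 ≤ P.a → 1 ≤ P.b → 0 ≤ P.β → 0 ≤ P.α → N ≤ Nbar →
      3 * K * (|Cin| * mollScale P.β P.α P.a P.b S.q ^ (2 * P.α)) ≤ 1 →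
      ∀ (i : ℕ), ∀ t ∈ tildeInterval S.T (P.τ S.q) i, ∀ m ≤ N,
        Torus.eContDiffHolderNorm (m + 1) 0 (𝒟.D i t) ≤
          ENNReal.ofReal (3 * K * (|Cin| * mollScale P.β P.α P.a P.b S.q ^ (2 * P.α)) *
            mollScale P.β P.α P.a P.b S.q ^ (-(m : ℝ))) := by
  obtain ⟨K, hK2, hK⟩ := displacement_allOrders (d := Fin 3) N
  refine ⟨K, hK2, ?_⟩
  intro P S Nbar Cin C₀ c₀ Cη H 𝒟 ha hb hβ hα hN hCFL i t ht m hm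
  have hK0 : 0 ≤ K := zero_le_two.trans hK2
  have hτ : 0 < P.τ S.q := glueScale_pos ha S.q
  have hℓ : 0 < mollScale P.β P.α P.a P.b S.q := mollScale_pos ha S.q
  have hℓ1 : mollScale P.β P.α P.a P.b S.q ≤ 1 := mollScale_le_one_of_params ha hb hβ hα S.q
  set ℓ := mollScale P.β P.α P.a P.b S.q with hℓdef
  set M := ℓ⁻¹ with hMdef
  have hM1 : 1 ≤ M := (one_le_inv₀ hℓ).2 hℓ1
  have hMk : ∀ k : ℕ, 1 ≤ M ^ k := fun k => one_le_pow₀ hM1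
  have hMpow : ∀ n : ℕ, ℓ ^ (-(n : ℝ)) = M ^ n := fun n => by
    rw [Real.rpow_neg hℓ.le, Real.rpow_natCast, hMdef, inv_pow]
  obtain ⟨hab, hsub, htJ, ht₀, hlen⟩ := tildeInterval_geometry H.pos_T hτ ht
  set a' := max 0 ((i : ℝ) * P.τ S.q - P.τ S.q) with ha'def
  set b' := min S.T ((i : ℝ) * P.τ S.q + 2 * P.τ S.q) with hb'def
  -- (2.19) in the form `‖v̄_q(s)‖_{j+1,0} ≤ Λ M^j`, `Λ = |C_in| δ_q^{1/2} λ_q`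
  set Λ := |Cin| * (Real.sqrt (amp P.β P.a P.b S.q) * freq P.a P.b S.q) with hΛdef
  have hX0 : 0 ≤ Real.sqrt (amp P.β P.a P.b S.q) * freq P.a P.b S.q :=
    mul_nonneg (Real.sqrt_nonneg _) (freq_pos ha _).le
  have hΛ0 : 0 ≤ Λ := mul_nonneg (abs_nonneg _) hX0
  have hΛτ : Λ * P.τ S.q = |Cin| * ℓ ^ (2 * P.α) :=
    velocityBound_mul_tau (P := P) (Cin := |Cin|) ha S.q
  have hvb : ∀ s ∈ Icc a' b', ∀ j ≤ N,
      Torus.eContDiffHolderNorm (j + 1) 0 (S.vbar s) ≤ ENNReal.ofReal (Λ * M ^ j) := by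
    intro s hs j hj
    refine (H.velocity j (hj.trans hN) s (hsub hs)).trans (ENNReal.ofReal_le_ofReal ?_)
    rw [hMpow j, hΛdef]
    calc Cin * (Real.sqrt (amp P.β P.a P.b S.q) * freq P.a P.b S.q * M ^ j)
        ≤ |Cin| * (Real.sqrt (amp P.β P.a P.b S.q) * freq P.a P.b S.q * M ^ j) :=
          mul_le_mul_of_nonneg_right (le_abs_self Cin) (mul_nonneg hX0 (zero_le_one.trans (hMk j)))
      _ = _ := by ring
  -- the transport equation of `D_i`, restricted to `J_i`
  have heq0 : ∀ s ∈ Icc 0 S.T, ∀ x, Torus.timeDerivWithin (Icc 0 S.T) (𝒟.D i) s x +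
      Torus.convect (S.vbar s) (𝒟.D i s) x = -S.vbar s x :=
    fun s hs x => eq_neg_of_add_eq_zero_left ((𝒟.flow i).transport s hs x)
  have hDsm : Torus.IsSmoothSpaceTimeOn (Icc 0 S.T) (𝒟.D i) := (𝒟.flow i).smooth
  have heq := transport_restrict hab hsub hDsm heq0
  -- smallness on `J_i`
  have hsmall : (b' - a') * Λ * K ≤ 1 := by
    calc (b' - a') * Λ * K ≤ (3 * P.τ S.q) * Λ * K :=
          mul_le_mul_of_nonneg_right (mul_le_mul_of_nonneg_right hlen hΛ0) hK0
      _ = 3 * K * (Λ * P.τ S.q) := by ring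
      _ = 3 * K * (|Cin| * ℓ ^ (2 * P.α)) := by rw [hΛτ]
      _ ≤ 1 := hCFL
  have h := hK hab (H.eulerReynolds.smooth_velocity.mono hsub) (hDsm.mono hsub) heq ht₀
    (𝒟.flow i).anchor hΛ0 hM1 hvb hsmall t htJ m hm
  refine h.trans (ENNReal.ofReal_le_ofReal ?_)
  rw [hMpow m]
  refine mul_le_mul_of_nonneg_right ?_ (zero_le_one.trans (hMk m))
  calc K * ((b' - a') * Λ) ≤ K * ((3 * P.τ S.q) * Λ) :=
        mul_le_mul_of_nonneg_left (mul_le_mul_of_nonneg_right hlen hΛ0) hK0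
    _ = 3 * K * (Λ * P.τ S.q) := by ring
    _ = 3 * K * (|Cin| * ℓ ^ (2 * P.α)) := by rw [hΛτ]

end Displacement

section Factors

variable {P : Params} {S : Setting} {Nbar : ℕ} {Cin C₀ c₀ : ℝ} {Cη : ℕ → ℕ → ℝ}

/-- **The normalising coefficient**: `0 ≤ Σ_j∫η_j²/ρ_q ≤ 8 λ_q^α/δ_{q+1}` on `[0,T]`, from
`Σ_j∫η_j² ∈ [0,1]` ((5.19)) and `ρ_q ≥ δ_{q+1}λ_q^{-α}/8` ((5.15), given
`4δ_{q+2} ≤ δ_{q+1}λ_q^{-α}`). [cite: BuckmasterEtAl2018, Lemma 5.4 (5.15), (5.19)] -/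
theorem PerturbationData.etaMass_div_rhoQ_le (H : CoreHypotheses P S Nbar Cin C₀)
    (𝒟 : PerturbationData P S c₀ Cη) (ha : 1 ≤ P.a)
    (h4 : 4 * amp P.β P.a P.b (S.q + 2) ≤ amp P.β P.a P.b (S.q + 1) * freq P.a P.b S.q ^ (-P.α))
    {t : ℝ} (ht : t ∈ Icc 0 S.T) :
    0 ≤ etaMass P S 𝒟.cut.η t / rhoQ P S t ∧
      etaMass P S 𝒟.cut.η t / rhoQ P S t ≤
        8 * freq P.a P.b S.q ^ P.α / amp P.β P.a P.b (S.q + 1) := by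
  have hδ : 0 < amp P.β P.a P.b (S.q + 1) := amp_pos ha _
  have hfr : 0 < freq P.a P.b S.q ^ (-P.α) := Real.rpow_pos_of_pos (freq_pos ha _) _
  have hρ : amp P.β P.a P.b (S.q + 1) * freq P.a P.b S.q ^ (-P.α) / 8 ≤ rhoQ P S t :=
    H.le_rhoQ h4 ht
  have hρ0 : 0 < rhoQ P S t := lt_of_lt_of_le (by positivity) hρ
  have hS1 : etaMass P S 𝒟.cut.η t ≤ 1 := 𝒟.etaMass_le_one ht
  have hS0 : 0 ≤ etaMass P S 𝒟.cut.η t :=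
    Finset.sum_nonneg fun j _ => integral_nonneg fun y => sq_nonneg _
  refine ⟨div_nonneg hS0 hρ0.le, ?_⟩
  rw [div_le_div_iff₀ hρ0 hδ]
  have h2 : 8 * freq P.a P.b S.q ^ P.α * (amp P.β P.a P.b (S.q + 1) * freq P.a P.b S.q ^ (-P.α) / 8) =
      amp P.β P.a P.b (S.q + 1) := by
    have h : freq P.a P.b S.q ^ P.α * freq P.a P.b S.q ^ (-P.α) = 1 := by
      rw [← Real.rpow_add (freq_pos ha _), add_neg_cancel, Real.rpow_zero]
    calc 8 * freq P.a P.b S.q ^ P.α * (amp P.β P.a P.b (S.q + 1) * freq P.a P.b S.q ^ (-P.α) / 8)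
        = amp P.β P.a P.b (S.q + 1) * (freq P.a P.b S.q ^ P.α * freq P.a P.b S.q ^ (-P.α)) := by ring
      _ = _ := by rw [h, mul_one]
  calc etaMass P S 𝒟.cut.η t * amp P.β P.a P.b (S.q + 1) ≤ 1 * amp P.β P.a P.b (S.q + 1) :=
        mul_le_mul_of_nonneg_right hS1 hδ.le
    _ = 8 * freq P.a P.b S.q ^ P.α * (amp P.β P.a P.b (S.q + 1) * freq P.a P.b S.q ^ (-P.α) / 8) := by
        rw [one_mul, h2]
    _ ≤ 8 * freq P.a P.b S.q ^ P.α * rhoQ P S t :=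
        mul_le_mul_of_nonneg_left hρ (mul_nonneg (by norm_num) (Real.rpow_nonneg (freq_pos ha _).le _))

/-- **The normalised stress `R_{q,i}/ρ_{q,i} = Id - (Σ_j∫η_j²/ρ_q) R̊̄_q` ((5.27)) at all levels**:
for `t ∈ [0,T]` and `j ≤ N ≤ N̄`, `‖Id - (Σ∫η²/ρ_q) R̊̄_q(t)‖_{j,0} ≤ (1 + 24|C_in|) ℓ^{-j}` — the
estimate (5.28) "`‖R_{q,i}/ρ_{q,i}‖_N ≲ 1 + (λ_q^α/δ_{q+1}) ‖R̊̄_q‖_{N+α} ≲ 1 + ℓ^{-N+α} λ_q^α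
≲ ℓ^{-N}`", from (5.15), (2.20), `‖·‖_{j,0} ≤ 3‖·‖_{j,α}` and `λ_q^α ℓ^α ≤ 1` (the matrix field
is written with `BDSV.ofColsCLM`, the continuous-linear form of `BDSV.ofCols`, of norm `≤ 1`).
[cite: BuckmasterEtAl2018, Prop. 5.7 (arXiv (5.27)–(5.28))] -/
theorem normalisedStress_scale_le (H : CoreHypotheses P S Nbar Cin C₀)
    (𝒟 : PerturbationData P S c₀ Cη) (ha : 1 ≤ P.a) (hb : 1 ≤ P.b) (hβ : 0 ≤ P.β) (hα : 0 ≤ P.α)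
    {N : ℕ} (hN : N ≤ Nbar)
    (h4 : 4 * amp P.β P.a P.b (S.q + 2) ≤ amp P.β P.a P.b (S.q + 1) * freq P.a P.b S.q ^ (-P.α))
    {t : ℝ} (ht : t ∈ Icc 0 S.T) :
    ∀ j ≤ N, Torus.eContDiffHolderNorm j 0
        ((fun _ : UnitAddTorus (Fin 3) => (1 : Matrix (Fin 3) (Fin 3) ℝ)) -
          (etaMass P S 𝒟.cut.η t / rhoQ P S t) • fun x => ofColsCLM (S.Rbar t x)) ≤
      ENNReal.ofReal ((1 + 24 * |Cin|) * mollScale P.β P.α P.a P.b S.q ^ (-(j : ℝ))) := by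
  intro j hj
  have hℓ : 0 < mollScale P.β P.α P.a P.b S.q := mollScale_pos ha S.q
  have hℓ1 : mollScale P.β P.α P.a P.b S.q ≤ 1 := mollScale_le_one_of_params ha hb hβ hα S.q
  have hδ : 0 < amp P.β P.a P.b (S.q + 1) := amp_pos ha _
  have hlam : 0 < freq P.a P.b S.q := freq_pos ha _
  have hlamℓ : freq P.a P.b S.q ^ P.α * mollScale P.β P.α P.a P.b S.q ^ P.α ≤ 1 := by
    calc freq P.a P.b S.q ^ P.α * mollScale P.β P.α P.a P.b S.q ^ P.α
        ≤ freq P.a P.b S.q ^ P.α * freq P.a P.b S.q ^ (-P.α) :=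
          mul_le_mul_of_nonneg_left (mollScale_rpow_le ha hb hβ hα S.q) (Real.rpow_nonneg hlam.le _)
      _ = 1 := by rw [← Real.rpow_add hlam, add_neg_cancel, Real.rpow_zero]
  set ℓ := mollScale P.β P.α P.a P.b S.q with hℓdef
  set c := etaMass P S 𝒟.cut.η t / rhoQ P S t with hcdef
  obtain ⟨hc0, hc⟩ := 𝒟.etaMass_div_rhoQ_le H ha h4 ht
  have hrpos : ∀ x : ℝ, 0 < ℓ ^ x := fun x => Real.rpow_pos_of_pos hℓ x
  -- smoothness
  have hR : IsSmooth (S.Rbar t) := H.eulerReynolds.smooth_stress.isSmooth_slice ht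
  have hF : IsSmooth (fun x => ofColsCLM (S.Rbar t x)) := hR.comp_clm ofColsCLM
  have h1 : IsContDiff j (fun _ : UnitAddTorus (Fin 3) => (1 : Matrix (Fin 3) (Fin 3) ℝ)) :=
    isContDiff_const _
  have hFj : IsContDiff j (fun x => ofColsCLM (S.Rbar t x)) :=
    hF.isContDiff (by exact_mod_cast le_top)
  have h2 : IsContDiff j (c • fun x => ofColsCLM (S.Rbar t x)) := hFj.smul c
  have hRj : IsContDiff j (S.Rbar t) := hR.isContDiff (by exact_mod_cast le_top)
  -- (2.20) in `C^{j,0}`, then through `ofCols` (norm `≤ 1`)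
  set X : ℝ := 3 * (|Cin| * (amp P.β P.a P.b (S.q + 1) * ℓ ^ (-(j : ℝ) + P.α))) with hXdef
  have hX0 : 0 ≤ X := mul_nonneg (by norm_num) (mul_nonneg (abs_nonneg _) (mul_nonneg hδ.le (hrpos _).le))
  have hst : Torus.eContDiffHolderNorm j 0 (S.Rbar t) ≤ ENNReal.ofReal X := by
    refine (Torus.eContDiffHolderNorm_exponent_zero_le j (Real.toNNReal P.α) _).trans ?_
    rw [hXdef, ENNReal.ofReal_mul (by norm_num), ENNReal.ofReal_ofNat]
    refine mul_le_mul' le_rfl ((H.stress j (hj.trans hN) t ht).trans (ENNReal.ofReal_le_ofReal ?_))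
    exact mul_le_mul_of_nonneg_right (le_abs_self Cin) (mul_nonneg hδ.le (hrpos _).le)
  have hFb : Torus.eContDiffHolderNorm j 0 (fun x => ofColsCLM (S.Rbar t x)) ≤ ENNReal.ofReal (1 * X) :=
    eContDiffHolderNorm_clm_comp_le_of_le ofColsCLM hRj
      (ContinuousLinearMap.opNorm_le_bound _ zero_le_one fun R =>
        (norm_ofCols_le R).trans_eq (one_mul _).symm) hst
  have hr1 : 1 ≤ ℓ ^ (-(j : ℝ)) :=
    Real.one_le_rpow_of_pos_of_le_one_of_nonpos hℓ hℓ1 (neg_nonpos.2 (Nat.cast_nonneg j))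
  have hsplit : ℓ ^ (-(j : ℝ) + P.α) = ℓ ^ (-(j : ℝ)) * ℓ ^ P.α := Real.rpow_add hℓ _ _
  -- the key real inequality `c X ≤ 24 |C_in| ℓ^{-j}`
  have key : |c| * (1 * X) ≤ 24 * |Cin| * ℓ ^ (-(j : ℝ)) := by
    rw [abs_of_nonneg hc0, one_mul, hXdef, hsplit]
    have hY : 0 ≤ 3 * (|Cin| * (amp P.β P.a P.b (S.q + 1) * (ℓ ^ (-(j : ℝ)) * ℓ ^ P.α))) :=
      mul_nonneg (by norm_num) (mul_nonneg (abs_nonneg _)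
        (mul_nonneg hδ.le (mul_nonneg (hrpos _).le (hrpos _).le)))
    have hZ : 0 ≤ 24 * |Cin| * ℓ ^ (-(j : ℝ)) :=
      mul_nonneg (mul_nonneg (by norm_num) (abs_nonneg _)) (hrpos _).le
    calc c * (3 * (|Cin| * (amp P.β P.a P.b (S.q + 1) * (ℓ ^ (-(j : ℝ)) * ℓ ^ P.α))))
        ≤ (8 * freq P.a P.b S.q ^ P.α / amp P.β P.a P.b (S.q + 1)) *
            (3 * (|Cin| * (amp P.β P.a P.b (S.q + 1) * (ℓ ^ (-(j : ℝ)) * ℓ ^ P.α)))) :=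
          mul_le_mul_of_nonneg_right hc hY
      _ = 24 * |Cin| * ℓ ^ (-(j : ℝ)) * (freq P.a P.b S.q ^ P.α * ℓ ^ P.α) := by
          field_simp
          ring
      _ ≤ 24 * |Cin| * ℓ ^ (-(j : ℝ)) * 1 := mul_le_mul_of_nonneg_left hlamℓ hZ
      _ = _ := mul_one _
  calc Torus.eContDiffHolderNorm j 0
        ((fun _ : UnitAddTorus (Fin 3) => (1 : Matrix (Fin 3) (Fin 3) ℝ)) -
          c • fun x => ofColsCLM (S.Rbar t x))
      ≤ Torus.eContDiffHolderNorm j 0 (fun _ : UnitAddTorus (Fin 3) => (1 : Matrix (Fin 3) (Fin 3) ℝ)) +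
          Torus.eContDiffHolderNorm j 0 (c • fun x => ofColsCLM (S.Rbar t x)) :=
        Torus.eContDiffHolderNorm_sub_le h1 h2
    _ ≤ ‖(1 : Matrix (Fin 3) (Fin 3) ℝ)‖ₑ + ‖c‖ₑ * ENNReal.ofReal (1 * X) := by
        rw [Torus.eContDiffHolderNorm_const_smul hFj c]
        exact add_le_add (eContDiffHolderNorm_const_le j 0 _) (mul_le_mul' le_rfl hFb)
    _ = ENNReal.ofReal (‖(1 : Matrix (Fin 3) (Fin 3) ℝ)‖ + |c| * (1 * X)) := by
        rw [ENNReal.ofReal_add (norm_nonneg _) (mul_nonneg (abs_nonneg _) (by rw [one_mul]; exact hX0)),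
          ofReal_norm, ENNReal.ofReal_mul (abs_nonneg _), Real.enorm_eq_ofReal_abs]
    _ ≤ ENNReal.ofReal ((1 + 24 * |Cin|) * ℓ ^ (-(j : ℝ))) := by
        refine ENNReal.ofReal_le_ofReal ?_
        have h1' : ‖(1 : Matrix (Fin 3) (Fin 3) ℝ)‖ ≤ 1 * ℓ ^ (-(j : ℝ)) :=
          matrixNorm_one_le.trans (by rw [one_mul]; exact hr1)
        calc ‖(1 : Matrix (Fin 3) (Fin 3) ℝ)‖ + |c| * (1 * X)
            ≤ 1 * ℓ ^ (-(j : ℝ)) + 24 * |Cin| * ℓ ^ (-(j : ℝ)) := add_le_add h1' key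
          _ = _ := by ring

end Factors

section Assembly

variable {P : Params} {S : Setting} {Nbar : ℕ} {Cin C₀ c₀ : ℝ} {Cη : ℕ → ℕ → ℝ}

/-- **(5.24) at a fixed time.** Under the standing hypotheses (`N ≤ N̄`,
`4δ_{q+2} ≤ δ_{q+1}λ_q^{-α}`), if `‖D_i(t)‖_{m+1,0} ≤ E ℓ^{-m}` for `m ≤ N` with `E ≤ 1` at some
`t ∈ [0,T]`, then `‖R̃_{q,i}(t)‖_{N,0} ≤ C ℓ^{-N}` with the explicit constant
`C = (3ᴺ(N+1)·3) · ((3ᴺ(N+1)·3 · 18(1 + 24|C_in|)) · 18)`: the printed assembly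
"`‖R̃_{q,i}‖_N ≲ ‖∇Φ_i‖_N ‖∇Φ_i‖₀ + ‖R_{q,i}/ρ_{q,i}‖_N`" as two Leibniz estimates for
`R̃ = (∇Φ_i M) ∇Φ_iᵀ`, `M = Id - (Σ∫η²/ρ_q)R̊̄_q`, through the continuous bilinear matrix product
`BDSV.mmul` (`‖A B‖ ≤ 3‖A‖‖B‖`) and the transposition `BDSV.mtranspose` (an isometry) of
`OnsagerBDSVMikadoBounds.lean`. [cite: BuckmasterEtAl2018, Prop. 5.7 (arXiv (5.24)), proof] -/
theorem eContDiffHolderNorm_tildeR_le (H : CoreHypotheses P S Nbar Cin C₀)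
    (𝒟 : PerturbationData P S c₀ Cη) (ha : 1 ≤ P.a) (hb : 1 ≤ P.b) (hβ : 0 ≤ P.β) (hα : 0 ≤ P.α)
    {N : ℕ} (hN : N ≤ Nbar)
    (h4 : 4 * amp P.β P.a P.b (S.q + 2) ≤ amp P.β P.a P.b (S.q + 1) * freq P.a P.b S.q ^ (-P.α))
    {E : ℝ} (hE1 : E ≤ 1) {i : ℕ} {t : ℝ} (ht : t ∈ Icc 0 S.T)
    (hDb : ∀ m ≤ N, Torus.eContDiffHolderNorm (m + 1) 0 (𝒟.D i t) ≤
      ENNReal.ofReal (E * mollScale P.β P.α P.a P.b S.q ^ (-(m : ℝ)))) :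
    Torus.eContDiffHolderNorm N 0 (tildeR P S 𝒟.cut.η 𝒟.D i t) ≤
      ENNReal.ofReal ((3 ^ N * ((N : ℝ) + 1) * 3) *
        ((3 ^ N * ((N : ℝ) + 1) * 3 * (18 * (1 + 24 * |Cin|))) * (1 * 18)) *
        mollScale P.β P.α P.a P.b S.q ^ (-(N : ℝ))) := by
  have hℓ : 0 < mollScale P.β P.α P.a P.b S.q := mollScale_pos ha S.q
  have hℓ1 : mollScale P.β P.α P.a P.b S.q ≤ 1 := mollScale_le_one_of_params ha hb hβ hα S.q
  have hDt : IsSmooth (𝒟.D i t) := (𝒟.flow i).smooth.isSmooth_slice ht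
  have hR : IsSmooth (S.Rbar t) := H.eulerReynolds.smooth_stress.isSmooth_slice ht
  set c := etaMass P S 𝒟.cut.η t / rhoQ P S t with hcdef
  -- the two factors at all levels
  have hG := gradPhi_scale_le hDt hℓ hℓ1 hE1 hDb
  have hM := normalisedStress_scale_le H 𝒟 ha hb hβ hα hN h4 ht
  have hA₂ : (0 : ℝ) ≤ 1 + 24 * |Cin| := by positivity
  -- smoothness of the factors
  have hGc : IsContDiff N (fun x => gradPhi 𝒟.D i t x) := isContDiff_gradPhi hDt N
  have hFN : IsContDiff N (fun x => ofColsCLM (S.Rbar t x)) :=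
    (hR.comp_clm ofColsCLM).isContDiff (by exact_mod_cast le_top)
  have hMc : IsContDiff N ((fun _ : UnitAddTorus (Fin 3) => (1 : Matrix (Fin 3) (Fin 3) ℝ)) -
      c • fun x => ofColsCLM (S.Rbar t x)) :=
    (isContDiff_const _).sub (hFN.smul c)
  -- operator norms: `‖mmul‖ ≤ 3`, `‖mtranspose‖ ≤ 1`
  have hmmul := ContinuousLinearMap.opNorm_le_bound₂ mmul (by norm_num : (0 : ℝ) ≤ 3)
    fun A B => matrixNorm_mul_le A B
  have hmt := ContinuousLinearMap.opNorm_le_bound mtranspose zero_le_one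
    fun A => ((Matrix.norm_transpose A).trans (one_mul _).symm).le
  -- first Leibniz: `∇Φ_i M`
  have hGM := eContDiffHolderNorm_bilinear_scale_le mmul hGc hMc hmmul hℓ (by norm_num) hA₂ hG hM
  have hGMc : IsContDiff N (fun x => gradPhi 𝒟.D i t x *
      ((fun _ : UnitAddTorus (Fin 3) => (1 : Matrix (Fin 3) (Fin 3) ℝ)) -
        c • fun x => ofColsCLM (S.Rbar t x)) x) :=
    isContDiff_matrix_mul hGc hMc
  have hGM' : ∀ k ≤ N, Torus.eContDiffHolderNorm k 0 (fun x => gradPhi 𝒟.D i t x *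
      ((fun _ : UnitAddTorus (Fin 3) => (1 : Matrix (Fin 3) (Fin 3) ℝ)) -
        c • fun x => ofColsCLM (S.Rbar t x)) x) ≤
        ENNReal.ofReal (3 ^ N * ((N : ℝ) + 1) * 3 * (18 * (1 + 24 * |Cin|)) *
          mollScale P.β P.α P.a P.b S.q ^ (-(k : ℝ))) := hGM
  -- the transpose
  have hGt := eContDiffHolderNorm_clm_scale_le mtranspose hGc hmt hG
  have hGtc : IsContDiff N (fun x => (gradPhi 𝒟.D i t x)ᵀ) := isContDiff_matrix_transpose hGc
  have hGt' : ∀ j ≤ N, Torus.eContDiffHolderNorm j 0 (fun x => (gradPhi 𝒟.D i t x)ᵀ) ≤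
      ENNReal.ofReal (1 * 18 * mollScale P.β P.α P.a P.b S.q ^ (-(j : ℝ))) := hGt
  -- second Leibniz
  have hA₃ : 0 ≤ 3 ^ N * ((N : ℝ) + 1) * 3 * (18 * (1 + 24 * |Cin|)) := by positivity
  have hA₄ : (0 : ℝ) ≤ 1 * 18 := by norm_num
  have hfin := eContDiffHolderNorm_bilinear_scale_le mmul hGMc hGtc hmmul hℓ hA₃ hA₄ hGM' hGt' N le_rfl
  have e : tildeR P S 𝒟.cut.η 𝒟.D i t = fun x => mmul (gradPhi 𝒟.D i t x *
      ((fun _ : UnitAddTorus (Fin 3) => (1 : Matrix (Fin 3) (Fin 3) ℝ)) -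
        c • fun x => ofColsCLM (S.Rbar t x)) x)
      ((gradPhi 𝒟.D i t x)ᵀ) := by
    funext x
    rfl
  rw [e]
  exact hfin

/-- **The conjugated-stress bound holds** (BDSV Prop. 5.7, second item, arXiv (5.24): for
`t ∈ Ĩ_i` and `N ≥ 0`, `‖R̃_{q,i}‖_N ≲ ℓ^{-N}`, constants depending on `N, α, β` (here also on
`|C_in|`) but not on `a`). Proof as printed: `‖∇Φ_i‖_j ≲ ℓ^{-j}` on `Ĩ_i` ((5.23), through the
all-orders displacement bound `BDSV.holder_displacement_tildeInterval` and the smallness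
`3K|C_in|ℓ^{2α} ≤ 1` for `a ≥ a₀`), `‖R_{q,i}/ρ_{q,i}‖_j ≲ ℓ^{-j}` ((5.27)–(5.28), which needs
(5.15), i.e. `4δ_{q+2} ≤ δ_{q+1}λ_q^{-α}`, true for `α < 2βb(b-1)` and `a ≥ a₁`), and two Leibniz
estimates. Thresholds: `α₀ = 2βb(b-1)`, `N̄ = N`. [cite: BuckmasterEtAl2018, Prop. 5.7 (arXiv (5.24))] -/
theorem tildeRBound_holds : tildeRBound := by
  intro c₀ _hc₀ Cη β hβ _hβ3 b hb1 _hb2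
  have hα₀ : 0 < 2 * β * b * (b - 1) :=
    mul_pos (mul_pos (mul_pos two_pos hβ) (by linarith)) (by linarith)
  refine ⟨2 * β * b * (b - 1), hα₀, ?_⟩
  intro α hα hαb N
  obtain ⟨K, hK2, hK⟩ := holder_displacement_tildeInterval N
  refine ⟨N, ?_⟩
  intro Cin C₀
  obtain ⟨a₁, ha₁1, ha₁⟩ := exists_threshold_four_amp hb1 hαb
  obtain ⟨a₂, _ha₂1, ha₂⟩ :=
    exists_threshold_mollScale_rpow_le hβ.le hb1.le hα (3 * K * |Cin|) one_pos
  refine ⟨(3 ^ N * ((N : ℝ) + 1) * 3) *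
      ((3 ^ N * ((N : ℝ) + 1) * 3 * (18 * (1 + 24 * |Cin|))) * (1 * 18)),
    max a₁ a₂, lt_max_of_lt_left ha₁1, ?_⟩
  intro a ha S H 𝒟 i t ht
  have ha1 : 1 ≤ a := ha₁1.le.trans ((le_max_left _ _).trans ha)
  have h4 := ha₁ a ((le_max_left _ _).trans ha) S.q
  have hCFL : 3 * K * (|Cin| * mollScale β α a b S.q ^ (2 * α)) ≤ 1 := by
    have h := ha₂ a ((le_max_right _ _).trans ha) S.q
    calc 3 * K * (|Cin| * mollScale β α a b S.q ^ (2 * α))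
        = 3 * K * |Cin| * mollScale β α a b S.q ^ (2 * α) := by ring
      _ ≤ 1 := h
  have ht0 : t ∈ Icc 0 S.T := tildeInterval_subset_Icc _ _ _ ht
  have hDb := hK H 𝒟 ha1 hb1.le hβ.le hα.le le_rfl hCFL i t ht
  exact eContDiffHolderNorm_tildeR_le H 𝒟 ha1 hb1.le hβ.le hα.le le_rfl h4 hCFL ht0 hDb

end Assembly

end DeRosa

/-! ## Port of `OnsagerBDSVPerturbationTildeR` -/

namespace DeRosa

open BDSV

open FunctionSpaces FunctionSpaces.Torus

/-- The flat three-torus `T³ = (ℝ/ℤ)³`, local notation. -/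
local notation "𝕋³" => UnitAddTorus (Fin 3)

/-- Euclidean `ℝ³`, local notation. -/
local notation "ℝ³" => EuclideanSpace ℝ (Fin 3)

section TildeR

variable {P : Params} {S : Setting} {Nbar : ℕ} {Cin C₀ c₀ : ℝ} {Cη : ℕ → ℕ → ℝ}

/-- The pointwise stress bound extracted from (2.20)|_{N=0}: `|R̊̄_{lk}| ≤ C_in δ_{q+1} ℓ^α` on
`[0,T] × T³` (for `C_in ≥ 0`, `a ≥ 1`). [cite: BuckmasterEtAl2018, §2.5 (2.20)] -/
theorem CoreHypotheses.abs_Rbar_le (H : CoreHypotheses P S Nbar Cin C₀) (hCin : 0 ≤ Cin)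
    (ha : 1 ≤ P.a) {s : ℝ} (hs : s ∈ Icc 0 S.T) (x : 𝕋³) (l k : Fin 3) :
    |S.Rbar s x l k| ≤ Cin * (amp P.β P.a P.b (S.q + 1) * mollScale P.β P.α P.a P.b S.q ^ P.α) := by
  have hR := H.stress 0 (Nat.zero_le _) s hs
  simp only [Nat.cast_zero, neg_zero, zero_add] at hR
  have hB : 0 ≤ Cin * (amp P.β P.a P.b (S.q + 1) * mollScale P.β P.α P.a P.b S.q ^ P.α) :=
    mul_nonneg hCin (mul_nonneg (amp_pos ha _).le (Real.rpow_nonneg (mollScale_pos ha _).le _))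
  have h1 := norm_le_of_eContDiffHolderNorm_zero_le hB hR x
  have h2 : |S.Rbar s x l k| ≤ ‖S.Rbar s x l‖ := by
    rw [← Real.norm_eq_abs]; exact PiLp.norm_apply_le _ k
  exact (h2.trans (norm_le_pi_norm _ l)).trans h1

/-- **Lemma 5.4, last assertion**: at points of `supp ηᵢ`, if the deformation bound
`exp(4C_in ℓ^{2α}) - 1 ≤ 1/300`, the stress bound `8 C_in λ_q^α ℓ^α ≤ 1/100` and
`4δ_{q+2} ≤ δ_{q+1}λ_q^{-α}` hold (all true for `a` large), then `R̃_{q,i}(x,t)` lies in the closed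
sup-ball of radius `1/10` about `Id` (`BDSV.mikadoRadius`; BDSV: `B_{1/2}(Id)`, from
`|R̃_{q,i} - Id| ≲ ℓ^α`). [cite: BuckmasterEtAl2018, Lemma 5.4 (R̃_{q,i} ∈ B_{1/2}(Id))] -/
theorem PerturbationData.tildeR_mem_closedBall (H : CoreHypotheses P S Nbar Cin C₀)
    (𝒟 : PerturbationData P S c₀ Cη) (hCin : 0 ≤ Cin) (ha : 1 ≤ P.a)
    (hdef : Real.exp (4 * (Cin * mollScale P.β P.α P.a P.b S.q ^ (2 * P.α))) - 1 ≤ 1 / 300)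
    (hstr : 8 * (Cin * (freq P.a P.b S.q ^ P.α * mollScale P.β P.α P.a P.b S.q ^ P.α)) ≤ 1 / 100)
    (h4 : 4 * amp P.β P.a P.b (S.q + 2) ≤ amp P.β P.a P.b (S.q + 1) * freq P.a P.b S.q ^ (-P.α))
    {i : ℕ} {t : ℝ} (ht : t ∈ Icc 0 S.T) {x' : 𝕋³} (hη : 𝒟.cut.η i t x' ≠ 0) (x : 𝕋³) :
    tildeR P S 𝒟.cut.η 𝒟.D i t x ∈ Metric.closedBall (1 : Matrix (Fin 3) (Fin 3) ℝ) mikadoRadius := by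
  -- the deformation `E = ∇D` and the normalised stress `N = (S/ρ) R̊̄`
  set E : Matrix (Fin 3) (Fin 3) ℝ := Matrix.of fun a b => Torus.partialDeriv b (𝒟.D i t) x a with hE
  set N : Matrix (Fin 3) (Fin 3) ℝ := (etaMass P S 𝒟.cut.η t / rhoQ P S t) • ofCols (S.Rbar t x) with hN
  have hG : gradPhi 𝒟.D i t x = 1 + E := rfl
  have hε : ∀ a b, |E a b| ≤ 1 / 300 := fun a b => by
    rw [hE, Matrix.of_apply]
    exact (𝒟.abs_partialDeriv_D_le_of_eta_ne_zero H hCin ha ht hη x a b).trans hdef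
  -- `ρ_q ≥ δλ^{-α}/8 > 0`, `S ≤ 1`
  have hδ : 0 < amp P.β P.a P.b (S.q + 1) := amp_pos ha _
  have hfr : 0 < freq P.a P.b S.q ^ (-P.α) := Real.rpow_pos_of_pos (freq_pos ha _) _
  have hρ : amp P.β P.a P.b (S.q + 1) * freq P.a P.b S.q ^ (-P.α) / 8 ≤ rhoQ P S t := H.le_rhoQ h4 ht
  have hρ0 : 0 < rhoQ P S t := lt_of_lt_of_le (by positivity) hρ
  have hS1 : etaMass P S 𝒟.cut.η t ≤ 1 := 𝒟.etaMass_le_one ht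
  have hS0 : 0 ≤ etaMass P S 𝒟.cut.η t :=
    Finset.sum_nonneg fun j _ => integral_nonneg fun y => sq_nonneg _
  have hc : etaMass P S 𝒟.cut.η t / rhoQ P S t ≤ 8 * freq P.a P.b S.q ^ P.α / amp P.β P.a P.b (S.q + 1) := by
    rw [div_le_div_iff₀ hρ0 hδ]
    have h1 : etaMass P S 𝒟.cut.η t * amp P.β P.a P.b (S.q + 1) ≤ 1 * amp P.β P.a P.b (S.q + 1) :=
      mul_le_mul_of_nonneg_right hS1 hδ.le
    have h2 : 8 * freq P.a P.b S.q ^ P.α * (amp P.β P.a P.b (S.q + 1) * freq P.a P.b S.q ^ (-P.α) / 8) =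
        amp P.β P.a P.b (S.q + 1) := by
      have : freq P.a P.b S.q ^ P.α * freq P.a P.b S.q ^ (-P.α) = 1 := by
        rw [← Real.rpow_add (freq_pos ha _), add_neg_cancel, Real.rpow_zero]
      calc 8 * freq P.a P.b S.q ^ P.α * (amp P.β P.a P.b (S.q + 1) * freq P.a P.b S.q ^ (-P.α) / 8)
          = amp P.β P.a P.b (S.q + 1) * (freq P.a P.b S.q ^ P.α * freq P.a P.b S.q ^ (-P.α)) := by ring
        _ = _ := by rw [this, mul_one]
    calc etaMass P S 𝒟.cut.η t * amp P.β P.a P.b (S.q + 1) ≤ amp P.β P.a P.b (S.q + 1) := by linarith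
      _ = 8 * freq P.a P.b S.q ^ P.α * (amp P.β P.a P.b (S.q + 1) * freq P.a P.b S.q ^ (-P.α) / 8) := h2.symm
      _ ≤ 8 * freq P.a P.b S.q ^ P.α * rhoQ P S t :=
          mul_le_mul_of_nonneg_left hρ (mul_nonneg (by norm_num) (Real.rpow_nonneg (freq_pos ha _).le _))
  have hc0 : 0 ≤ etaMass P S 𝒟.cut.η t / rhoQ P S t := div_nonneg hS0 hρ0.le
  have hNb : ∀ a b, |N a b| ≤ 1 / 100 := fun a b => by
    rw [hN, Matrix.smul_apply, ofCols_apply, smul_eq_mul, abs_mul, abs_of_nonneg hc0]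
    have hR := H.abs_Rbar_le hCin ha ht x b a
    calc etaMass P S 𝒟.cut.η t / rhoQ P S t * |S.Rbar t x b a|
        ≤ (8 * freq P.a P.b S.q ^ P.α / amp P.β P.a P.b (S.q + 1)) *
            (Cin * (amp P.β P.a P.b (S.q + 1) * mollScale P.β P.α P.a P.b S.q ^ P.α)) :=
          mul_le_mul hc hR (abs_nonneg _)
            (div_nonneg (mul_nonneg (by norm_num) (Real.rpow_nonneg (freq_pos ha _).le _)) hδ.le)
      _ = 8 * (Cin * (freq P.a P.b S.q ^ P.α * mollScale P.β P.α P.a P.b S.q ^ P.α)) := by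
          field_simp
      _ ≤ 1 / 100 := hstr
  have key := abs_conj_sub_one_le hε (by norm_num) hNb (by norm_num)
  rw [Metric.mem_closedBall, dist_eq_norm]
  refine (pi_norm_le_iff_of_nonneg (by norm_num [mikadoRadius])).2 fun a =>
    (pi_norm_le_iff_of_nonneg (by norm_num [mikadoRadius])).2 fun b => ?_
  rw [Real.norm_eq_abs]
  have hx : (tildeR P S 𝒟.cut.η 𝒟.D i t x - 1) a b =
      ((1 + E) * (1 - N) * (1 + E)ᵀ - 1 : Matrix (Fin 3) (Fin 3) ℝ) a b := by
    rw [tildeR, hG]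
  rw [hx]
  refine (key a b).trans ?_
  norm_num [mikadoRadius]

end TildeR

end DeRosa

end Literature.Analysis.FluidPDE
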